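import Literature.Computability.Complexity.SparseSetsUpwardSeparationTally
import Literature.Computability.Complexity.CodeFPLists
import HarnessLib

/-!
# Sparse sets in `NP − P`, II: the census decider, and Corollary 4 of Hartmanis–Immerman–Sewelson

Topic `Literature/Computability/Complexity`. Second (and last) file of the discharge of the named
fact `hartmanisImmermanSewelson1985_cor4` (`SparseSetsUpwardSeparation.lean`; Information and
Control 65 (1985), Cor. 4, p. 166: "there exist sparse sets in `NP − P` if and only if there exist
tally sets in `NP − P`"), continuing `SparseSetsUpwardSeparationTally.lean` (the census tally set
`SparseTally.tallyOf S ⊆ 0*` and `tallyOf_mem_NP`).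

This file is the deterministic half of the upward separation method, Theorem 1 (`⇒`) of the paper
(p. 164), run against the tally set instead of the `EXPTIME` set `S'`:

> "Given `x` of length `n`, we first find the exact census of `S` … we run our exponential time
> algorithm for membership in `S'` on the `p(n)` pairs of strings `n#i#0#1#0` and `n#i#0#1#1` …
> `cₙ` will be the `i − 1`, where `i` is the least integer such that both [are not] in `S'` …
> Knowing the census `cₙ` … we simply run our exponential time algorithm for `S'` on
> `{n#i#j#k#d | …, k = 1, …, n, with d the appropriate character of x}`. `x` will be in `S` if and
> only if for some pair `i₀` and `j₀` all of the appropriate `n#i₀#j₀#k#d` are in `S'`."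

* §A — chains in the finite slice `S ∩ Σⁿ`: a chain is no longer than the census
  (`IsChain.length_le`), the sorted enumeration is a chain onto the slice
  (`exists_chain_of_finset`), and two chains of census length coincide (`IsChain.eq_of_length_eq`);
* §B — hence the census queries `⟨0, n, i⟩` answer "`i ≤ |S ∩ Σⁿ|`" (`nameOK_census_iff`) and, AT
  the census, the naming queries `⟨1, n, c, r, k⟩` read the bits of the `r`-th word of THE chain
  (`nameOK_naming_iff`);
* §C — the census decider `SparseTally.dec c O x` (try every candidate census `i ≤ |x|^c + c`,
  detect the census by two census queries, then look for a row whose `|x|` naming bits spell `x`)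
  and its correctness `dec_eq_true_iff` for a language of census `≤ n^c + c` and an oracle bit `O`
  answering `0^{⟨q⟩}` by `NameOK S q`;
* §D — `dec c O` is polynomial time for a polynomial-time `O` (typed toolkit `CodeFP`: the queries
  have polynomially bounded codes, `pair5_lt_Qpoly`, so the capped binary-to-unary conversion
  `CodeFP.unOfNatMin` writes them; loops are `CodeFP.any`/`CodeFP.all` over `CodeFP.urange`/`rangeOf`);
* §E — **`SparseTally.mem_P_of_tallyOf_mem_P`**: `S` sparse, `tallyOf S ∈ P ⟹ S ∈ P`; and the
  discharge **`hartmanisImmermanSewelson1985_cor4_holds`**.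

The route through `EXPTIME`/`NEXPTIME` printed for Cor. 4 (Theorem 1, then Book 1974) pads the
names to exponential length and translates back to tally; composing the two is the identity on the
tally scale, which is what is formalized here, so neither `hartmanisImmermanSewelson1985_thm1` nor
`book1974_thm1` is used. No named fact and no definition of mathematical content is introduced
(D-0026): `Qpoly`, `qcap`, `bitTest`, `rowTest`, `censusTest`, `dec` are proof devices (namespace
`SparseTally`).

## References

* J. Hartmanis, N. Immerman, V. Sewelson, *Sparse sets in NP−P: EXPTIME versus NEXPTIME*,
  Information and Control 65 (1985) 158–181: Theorem 1 and its proof (pp. 163–164), Corollary 4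
  (p. 166) (held: `paper:doi-10-1016-s0019-9958-85-80004-8`, p0006–p0009).
  [HartmanisImmermanSewelson1985]
* S. Arora, B. Barak, *Computational Complexity: A Modern Approach*, CUP 2009, §1.3 (polynomial
  time is closed under composition and polynomially bounded loops).
-/

noncomputable section

namespace Literature.Computability.Complexity

open _root_.Computability Polynomial CodeFP Nondeterministic
open Literature.Barriers.PneNP (IsSparseLanguage IsTally finite_slice)

namespace SparseTally



/-! ### A. Chains in a finite slice: length, existence, uniqueness -/

/-- The value order is irreflexive, so chains have no duplicates. [folklore] -/
theorem IsChain.nodup {S : Language Bool} {n : ℕ} {l : List (List Bool)} (h : IsChain S n l) : l.Nodup :=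
  h.2.imp fun hab heq => by subst heq; exact lt_irrefl _ hab

/-- The words of a chain lie in the slice `S ∩ Σⁿ`. [folklore] -/
theorem IsChain.toFinset_subset {S : Language Bool} {n : ℕ} {l : List (List Bool)} (h : IsChain S n l) :
    l.toFinset ⊆ (finite_slice S n).toFinset := by
  intro z hz
  rw [List.mem_toFinset] at hz
  rw [Set.Finite.mem_toFinset]
  exact ⟨(h.1 z hz).2, (h.1 z hz).1⟩

/-- **A chain is at most as long as the census** `|S ∩ Σⁿ|`. [cite: HartmanisImmermanSewelson1985, proof of Theorem 1 (p. 164: "asking if … is in S' is simply asking if there are at least i strings of length n in S")] -/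
theorem IsChain.length_le {S : Language Bool} {n : ℕ} {l : List (List Bool)} (h : IsChain S n l) :
    l.length ≤ (finite_slice S n).toFinset.card := by
  rw [← List.toFinset_card_of_nodup h.nodup]
  exact Finset.card_le_card h.toFinset_subset

/-- Prefixes of chains are chains. [folklore] -/
theorem IsChain.take {S : Language Bool} {n : ℕ} {l : List (List Bool)} (h : IsChain S n l) (i : ℕ) :
    IsChain S n (l.take i) :=
  ⟨fun z hz => h.1 z (List.mem_of_mem_take hz), h.2.sublist (List.take_sublist _ _)⟩

/-- **The sorted enumeration of a finite set of words of one length is a chain onto it** (induction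
on the word of maximal value). [cite: HartmanisImmermanSewelson1985, proof of Theorem 1 (p. 163: "assume that the elements of S are lexicographically ordered")] -/
theorem exists_chain_of_finset (S : Language Bool) (n : ℕ) (F : Finset (List Bool))
    (hF : ∀ z ∈ F, z.length = n ∧ z ∈ S) :
    ∃ L : List (List Bool), IsChain S n L ∧ L.toFinset = F := by
  classical
  induction F using Finset.induction_on_max_value bitsToNat with
  | empty => exact ⟨[], ⟨fun z hz => by simp at hz, List.Pairwise.nil⟩, rfl⟩
  | insert a s has hmax ih =>
    obtain ⟨L, hL, hLs⟩ := ih fun z hz => hF z (Finset.mem_insert_of_mem hz)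
    have ha : a.length = n ∧ a ∈ S := hF a (Finset.mem_insert_self a s)
    refine ⟨L ++ [a], ⟨fun z hz => ?_, ?_⟩, ?_⟩
    · rcases List.mem_append.1 hz with hz | hz
      · exact hL.1 z hz
      · rw [List.mem_singleton.1 hz]; exact ha
    · rw [List.pairwise_append]
      refine ⟨hL.2, List.pairwise_singleton _ _, fun x hx b hb => ?_⟩
      rw [List.mem_singleton.1 hb]
      have hxs : x ∈ s := by rw [← hLs]; exact List.mem_toFinset.2 hx
      have hle := hmax x hxs
      have hne : bitsToNat x ≠ bitsToNat a := fun he =>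
        has (Kannan.eq_of_bitsToNat_eq ((hL.1 x hx).1.trans ha.1.symm) he ▸ hxs)
      exact lt_of_le_of_ne hle hne
    · ext z
      simp [hLs]

/-- **Two chains of census length coincide** (both are the sorted enumeration of `S ∩ Σⁿ`). [cite: HartmanisImmermanSewelson1985, proof of Theorem 1 (p. 164: "knowing the census … all of the n#i₀#j₀#k#d in S' will describe x")] -/
theorem IsChain.eq_of_length_eq {S : Language Bool} {n : ℕ} {l₁ l₂ : List (List Bool)} (h₁ : IsChain S n l₁)
    (h₂ : IsChain S n l₂) (hl₁ : l₁.length = (finite_slice S n).toFinset.card)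
    (hl₂ : l₂.length = (finite_slice S n).toFinset.card) : l₁ = l₂ := by
  have ht : ∀ {l : List (List Bool)}, IsChain S n l → l.length = (finite_slice S n).toFinset.card →
      l.toFinset = (finite_slice S n).toFinset := fun h hl =>
    Finset.eq_of_subset_of_card_le h.toFinset_subset (by rw [List.toFinset_card_of_nodup h.nodup, hl])
  have hperm : l₁.Perm l₂ :=
    List.perm_of_nodup_nodup_toFinset_eq h₁.nodup h₂.nodup ((ht h₁ hl₁).trans (ht h₂ hl₂).symm)
  exact hperm.eq_of_pairwise (fun a b _ _ hab hba => absurd (hab.trans hba) (lt_irrefl _)) h₁.2 h₂.2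

/-- Membership in a chain of census length is membership in the slice. [folklore] -/
theorem IsChain.mem_iff {S : Language Bool} {n : ℕ} {l : List (List Bool)} (h : IsChain S n l)
    (hl : l.length = (finite_slice S n).toFinset.card) {x : List Bool} :
    x ∈ l ↔ x ∈ S ∧ x.length = n := by
  have ht : l.toFinset = (finite_slice S n).toFinset :=
    Finset.eq_of_subset_of_card_le h.toFinset_subset (by rw [List.toFinset_card_of_nodup h.nodup, hl])
  rw [← List.mem_toFinset, ht, Set.Finite.mem_toFinset]
  rfl

/-! ### B. The meaning of census and naming queries -/

section Meaning

variable (S : Language Bool) (n : ℕ)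

/-- **Census queries**: `⟨0, n, i, ·, ·⟩` holds iff `i ≤ |S ∩ Σⁿ|`. [cite: HartmanisImmermanSewelson1985, proof of Theorem 1 (p. 164)] -/
theorem nameOK_census_iff (i r k : ℕ) :
    NameOK S (0, n, i, r, k) ↔ i ≤ (finite_slice S n).toFinset.card := by
  constructor
  · rintro ⟨l, hl, hch, -⟩
    dsimp only at hl hch
    rw [← hl]; exact hch.length_le
  · intro hi
    obtain ⟨L, hL, hLF⟩ := exists_chain_of_finset S n (finite_slice S n).toFinset
      (fun z hz => by rw [Set.Finite.mem_toFinset] at hz; exact ⟨hz.2, hz.1⟩)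
    have hlen : L.length = (finite_slice S n).toFinset.card := by
      rw [← hLF, List.toFinset_card_of_nodup hL.nodup]
    exact ⟨L.take i, by rw [List.length_take]; dsimp only; omega, hL.take i, Or.inl rfl⟩

/-- **Naming queries at the census**: `⟨1, n, c, r, k⟩` with `c = |S ∩ Σⁿ|` holds iff the `k`-th bit of
the `r`-th word of THE chain of census length is `1`. [cite: HartmanisImmermanSewelson1985, proof of Theorem 1 (p. 164)] -/
theorem nameOK_naming_iff {L : List (List Bool)} (hL : IsChain S n L)
    (hlen : L.length = (finite_slice S n).toFinset.card) (r k : ℕ) :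
    NameOK S (1, n, (finite_slice S n).toFinset.card, r, k) ↔ (L.getD r []).getD k false = true := by
  constructor
  · rintro ⟨l, hl, hch, hcond⟩
    rcases hcond with h0 | ⟨-, hbit⟩
    · exact absurd h0 one_ne_zero
    · rwa [hch.eq_of_length_eq hL hl hlen] at hbit
  · intro hbit
    exact ⟨L, hlen, hL, Or.inr ⟨rfl, hbit⟩⟩

end Meaning


/-! ### C. The census decider (mathematical form) and its correctness -/

section Decider

variable (c : ℕ) (O : List Bool → Bool)

/-- A polynomial bounding the codes of all names queried on inputs of length `n`. [folklore] -/
def Qpoly (c : ℕ) : Polynomial ℕ := ((((X ^ c + C c + X + 2) ^ 2 + 1) ^ 2 + 1) ^ 2 + 1) ^ 2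

/-- Value of the bounding polynomial. [folklore] -/
theorem Qpoly_eval (c n : ℕ) :
    (Qpoly c).eval n = ((((n ^ c + c + n + 2) ^ 2 + 1) ^ 2 + 1) ^ 2 + 1) ^ 2 := by
  simp [Qpoly]

/-- Cantor pairing below a square. [folklore] -/
theorem pair_lt_sq {a b B : ℕ} (ha : a < B) (hb : b < B) : Nat.pair a b < B ^ 2 :=
  (Nat.pair_lt_max_add_one_sq a b).trans_le (Nat.pow_le_pow_left (Nat.succ_le_of_lt (max_lt ha hb)) 2)

/-- **The queried names have polynomially bounded codes** ("the `n#i#j#k#d`'s that correspond to `x`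
are of length `O(log n)` due to the sparseness of `S`", item 1 of p. 164; here: the tally query has
polynomial length). [cite: HartmanisImmermanSewelson1985, proof of Theorem 1 (p. 164, item 1)] -/
theorem pair5_lt_Qpoly {c t n i r k : ℕ} (ht : t ≤ 1) (hi : i ≤ n ^ c + c + 1) (hr : r ≤ n ^ c + c + 1)
    (hk : k ≤ n) : pair5 (t, n, i, r, k) < (Qpoly c).eval n := by
  rw [Qpoly_eval]
  set B := n ^ c + c + n + 2 with hB
  have hBsq : B ≤ B ^ 2 := Nat.le_self_pow two_ne_zero B
  have h4 : Nat.pair r k < B ^ 2 := pair_lt_sq (by omega) (by omega)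
  have h3 : Nat.pair i (Nat.pair r k) < (B ^ 2 + 1) ^ 2 := pair_lt_sq (by omega) (by omega)
  have hB2 : B ^ 2 + 1 ≤ (B ^ 2 + 1) ^ 2 := Nat.le_self_pow two_ne_zero _
  have h2 : Nat.pair n (Nat.pair i (Nat.pair r k)) < ((B ^ 2 + 1) ^ 2 + 1) ^ 2 :=
    pair_lt_sq (by omega) (by omega)
  have hB3 : (B ^ 2 + 1) ^ 2 + 1 ≤ ((B ^ 2 + 1) ^ 2 + 1) ^ 2 := Nat.le_self_pow two_ne_zero _
  have h1 : Nat.pair t (Nat.pair n (Nat.pair i (Nat.pair r k))) < (((B ^ 2 + 1) ^ 2 + 1) ^ 2 + 1) ^ 2 :=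
    pair_lt_sq (by omega) (by omega)
  exact h1

/-- **The capped query word** of a name on input `x`: `0^{min ⟨q⟩ Q(|x|)}` (the cap makes the
binary-to-unary conversion polynomial; it never bites on the names the decider queries). [folklore] -/
def qcap (x : List Bool) (q : Name) : List Bool :=
  List.replicate (min (pair5 q) ((Qpoly c).eval x.length)) false

/-- Below the cap the query word is `0^{⟨q⟩}`. [folklore] -/
theorem qcap_eq {c : ℕ} {x : List Bool} {q : Name} (h : pair5 q < (Qpoly c).eval x.length) :
    qcap c x q = List.replicate (pair5 q) false := by
  rw [qcap, min_eq_left h.le]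

/-- The bit test of the decider: oracle bit of the naming query `⟨1, |x|, i, r, k⟩` against the `k`-th
bit of `x`. [cite: HartmanisImmermanSewelson1985, proof of Theorem 1 (p. 164: "with d the appropriate character of x")] -/
def bitTest (x : List Bool) (i r k : ℕ) : Bool :=
  O (qcap c x (1, x.length, i, r, k)) == bitB x (min k x.length)

/-- The row test: all `|x|` bits of the `r`-th word agree with `x`. [cite: HartmanisImmermanSewelson1985, proof of Theorem 1 (p. 164)] -/
def rowTest (x : List Bool) (i r : ℕ) : Bool :=
  (List.range x.length).all fun k => bitTest c O x i r k

/-- The census test at `i`: `i` is the census (`⟨0,|x|,i⟩` holds, `⟨0,|x|,i+1⟩` fails) and some row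
`r < i` spells `x`. [cite: HartmanisImmermanSewelson1985, proof of Theorem 1 (p. 164: "cₙ will be the i − 1, where i is the least integer such that …")] -/
def censusTest (x : List Bool) (i : ℕ) : Bool :=
  (O (qcap c x (0, x.length, i, 0, 0)) && !O (qcap c x (0, x.length, i + 1, 0, 0))) &&
    (List.range (min i (x.length ^ c + c + 1))).any fun r => rowTest c O x i r

/-- **The census decider** for `S` relative to the oracle bit `O` of its census tally set: try every
candidate census `i ≤ |x|^c + c`. [cite: HartmanisImmermanSewelson1985, proof of Theorem 1 (p. 164)] -/
def dec (x : List Bool) : Bool :=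
  (List.range (x.length ^ c + c + 1)).any fun i => censusTest c O x i

variable {c O}

/-- Words are determined by their first `n` bits when both have length `n`. [folklore] -/
theorem eq_of_getD_eq {u v : List Bool} (hu : u.length = v.length)
    (h : ∀ k < u.length, u.getD k false = v.getD k false) : u = v :=
  List.ext_getElem hu fun k h₁ h₂ => by
    have := h k h₁
    rwa [List.getD_eq_getElem _ _ h₁, List.getD_eq_getElem _ _ h₂] at this

/-- **Correctness of the census decider** (Hartmanis–Immerman–Sewelson, proof of Theorem 1,
pp. 164: find the census `cₙ` by the census queries, then "x will be in S if and only if for some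
[row] all of the appropriate [naming queries] are in S'"). Hypotheses: the census of `S` is at most
`n^c + c`, and `O` answers the queries `0^{⟨q⟩}` by `NameOK S q`. [cite: HartmanisImmermanSewelson1985, proof of Theorem 1 (p. 164)] -/
theorem dec_eq_true_iff {S : Language Bool} {c : ℕ}
    (hc : ∀ n, {x | x ∈ S ∧ x.length = n}.ncard ≤ n ^ c + c) {O : List Bool → Bool}
    (hO : ∀ q : Name, O (List.replicate (pair5 q) false) = true ↔ NameOK S q) (x : List Bool) :
    dec c O x = true ↔ x ∈ S := by
  obtain ⟨cs, hcs⟩ : ∃ cs : ℕ, cs = (finite_slice S x.length).toFinset.card := ⟨_, rfl⟩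
  have hcsN : cs ≤ x.length ^ c + c := by
    have h := hc x.length
    rwa [Set.ncard_eq_toFinset_card _ (finite_slice S x.length), ← hcs] at h
  obtain ⟨L, hL, hLF⟩ := exists_chain_of_finset S x.length (finite_slice S x.length).toFinset
    (fun z hz => by rw [Set.Finite.mem_toFinset] at hz; exact ⟨hz.2, hz.1⟩)
  have hlen : L.length = (finite_slice S x.length).toFinset.card := by
    rw [← hLF, List.toFinset_card_of_nodup hL.nodup]
  have hlen' : L.length = cs := hlen.trans hcs.symm
  -- reading the oracle on the queried names
  have hcensus : ∀ i, i ≤ x.length ^ c + c + 1 →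
      (O (qcap c x (0, x.length, i, 0, 0)) = true ↔ i ≤ cs) := fun i hi => by
    rw [qcap_eq (pair5_lt_Qpoly (c := c) zero_le_one hi (Nat.zero_le _) (Nat.zero_le _)), hO,
      nameOK_census_iff, ← hcs]
  have hnaming : ∀ r k, r ≤ x.length ^ c + c + 1 → k ≤ x.length →
      (O (qcap c x (1, x.length, cs, r, k)) = true ↔ (L.getD r []).getD k false = true) :=
    fun r k hr hk => by
    rw [qcap_eq (pair5_lt_Qpoly (c := c) le_rfl (by omega) hr hk), hO, hcs,
      nameOK_naming_iff S x.length hL hlen]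
  -- the row test at the census spells membership in `L`
  have hrow : ∀ r, r < cs → (rowTest c O x cs r = true ↔ L.getD r [] = x) := fun r hr => by
    have hrL : L.getD r [] ∈ L := by
      rw [List.getD_eq_getElem _ _ (by omega)]; exact List.getElem_mem _
    have hrlen : (L.getD r []).length = x.length := (hL.1 _ hrL).1
    simp only [rowTest, List.all_eq_true, List.mem_range]
    constructor
    · intro h
      refine eq_of_getD_eq hrlen fun k hk => ?_
      rw [hrlen] at hk
      have hb := h k hk
      simp only [bitTest, bitB_eq_getD, beq_iff_eq] at hb
      rw [min_eq_left hk.le] at hb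
      rw [← hb, Bool.eq_iff_iff, hnaming r k (by omega) hk.le]
    · intro h k hk
      simp only [bitTest, bitB_eq_getD, beq_iff_eq]
      rw [min_eq_left hk.le, Bool.eq_iff_iff, hnaming r k (by omega) hk.le, h]
  -- the census test succeeds exactly at `i = cs`, and then says `x ∈ L`
  have hct : ∀ i, i < x.length ^ c + c + 1 → (censusTest c O x i = true ↔ i = cs ∧ x ∈ L) :=
    fun i hi => by
    simp only [censusTest, Bool.and_eq_true, Bool.not_eq_true', List.any_eq_true, List.mem_range]
    rw [hcensus i hi.le, ← Bool.not_eq_true, hcensus (i + 1) (by omega)]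
    constructor
    · rintro ⟨⟨h₁, h₂⟩, r, hr, hrow'⟩
      have hic : i = cs := by omega
      subst hic
      rw [lt_min_iff] at hr
      refine ⟨rfl, ?_⟩
      rw [← (hrow r hr.1).1 hrow', List.getD_eq_getElem _ _ (by omega)]
      exact List.getElem_mem _
    · rintro ⟨rfl, hx⟩
      refine ⟨⟨le_rfl, by omega⟩, ?_⟩
      obtain ⟨r, hr, hrx⟩ := List.getElem_of_mem hx
      refine ⟨r, lt_min (by omega) (by omega), (hrow r (by omega)).2 ?_⟩
      rw [List.getD_eq_getElem _ _ hr, hrx]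
  -- assemble
  rw [dec]
  simp only [List.any_eq_true, List.mem_range]
  constructor
  · rintro ⟨i, hi, hct'⟩
    obtain ⟨-, hx⟩ := (hct i hi).1 hct'
    exact ((hL.mem_iff hlen).1 hx).1
  · intro hx
    exact ⟨cs, by omega, (hct cs (by omega)).2 ⟨rfl, (hL.mem_iff hlen).2 ⟨hx, rfl⟩⟩⟩

end Decider


/-! ### D. The census decider is polynomial time (typed toolkit `CodeFP`) -/

section DeciderFP

variable (c : ℕ) {O : List Bool → Bool}

/-- The unary budget `1^{Q(|x|)}` (`Plumb.polyFn`). [folklore] -/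
theorem budgetC : CodeFP strE unE (fun x => (Qpoly c).eval x.length) :=
  of_fn (Plumb.polyFn (Qpoly c)) (Plumb.polyFn_mem_FP _) fun x => by rw [Plumb.polyFn_apply, unE_eq_ones]; rfl

/-- The unary census budget `1^{|x|^c + c + 1}`. [folklore] -/
theorem nbudgetC : CodeFP strE unE (fun x => x.length ^ c + c + 1) :=
  of_fn (Plumb.polyFn (X ^ c + Polynomial.C c + 1)) (Plumb.polyFn_mem_FP _) fun x => by
    rw [Plumb.polyFn_apply, unE_eq_ones]
    simp

/-- **Writing a query is polynomial time**: `(x, q) ↦ 0^{min ⟨q⟩ Q(|x|)}` (code the name in binary,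
convert to unary below the budget, rewrite `1`s to `0`s). [cite: HartmanisImmermanSewelson1985, proof of Theorem 1 (p. 164, item 1)] -/
theorem qcapC : CodeFP (pairE strE nameE) strE (fun p => qcap c p.1 p.2) := by
  -- `1ᵐ ↦ 0ᵐ` is the zero-word brick `Kannan.zerosFn` (cf. `Literature.Barriers.QuantumAdvantage.zeros_code`)
  have hz : CodeFP unE strE (fun m => List.replicate m false) :=
    of_fn Kannan.zerosFn Kannan.zerosFn_mem_FP fun m => by rw [Kannan.zerosFn_apply, length_unE]; rfl
  exact (hz.comp (unOfNatMin.comp (((budgetC c).comp (fst _ _)).pair (pair5C.comp (snd _ _))))).congr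
    fun _ => by dsimp only [qcap]

variable {c}
variable (hO : CodeFP strE bitE O)
include hO

/-- The bit test is polynomial time. [folklore] -/
theorem bitTestC : CodeFP (pairE (pairE (pairE strE natE) natE) natE) bitE
    (fun v => bitTest c O v.1.1.1 v.1.1.2 v.1.2 v.2) := by
  have hx : CodeFP (pairE (pairE (pairE strE natE) natE) natE) strE (fun v => v.1.1.1) :=
    (fst _ _).fst'.fst'
  have hi : CodeFP (pairE (pairE (pairE strE natE) natE) natE) natE (fun v => v.1.1.2) :=
    (fst _ _).fst'.snd'
  have hr : CodeFP (pairE (pairE (pairE strE natE) natE) natE) natE (fun v => v.1.2) := (fst _ _).snd'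
  have hk : CodeFP (pairE (pairE (pairE strE natE) natE) natE) natE (fun v => v.2) := snd _ _
  have hname : CodeFP (pairE (pairE (pairE strE natE) natE) natE) nameE
      (fun v => ((1 : ℕ), v.1.1.1.length, v.1.1.2, v.1.2, v.2)) :=
    (const _ (1 : ℕ)).pair ((strNatLength.comp hx).pair (hi.pair (hr.pair hk)))
  have hq : CodeFP (pairE (pairE (pairE strE natE) natE) natE) strE
      (fun v => qcap c v.1.1.1 (1, v.1.1.1.length, v.1.1.2, v.1.2, v.2)) :=
    ((qcapC c).comp (hx.pair hname)).congr fun _ => by dsimp only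
  have hkU : CodeFP (pairE (pairE (pairE strE natE) natE) natE) unE (fun v => min v.2 v.1.1.1.length) :=
    unOfNatMin.comp ((strLength.comp hx).pair hk)
  have hxbit : CodeFP (pairE (pairE (pairE strE natE) natE) natE) bitE
      (fun v => bitB v.1.1.1 (min v.2 v.1.1.1.length)) :=
    (bitBC.comp (hx.pair hkU)).congr fun _ => by dsimp only
  exact ((beq bitE_injective).comp ((hO.comp hq).pair hxbit)).congr fun _ => by dsimp only [bitTest]

/-- The row test is polynomial time (a loop over the bits of `x`). [folklore] -/
theorem rowTestC : CodeFP (pairE (pairE strE natE) natE) bitE (fun v => rowTest c O v.1.1 v.1.2 v.2) :=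
  ((all (bitTestC (c := c) hO)).comp ((CodeFP.id _).pair (urange.comp (strLength.comp (fst _ _).fst')))).congr
    fun _ => by dsimp only [rowTest, id]

/-- The census test is polynomial time (two census queries and a loop over the rows). [folklore] -/
theorem censusTestC : CodeFP (pairE strE natE) bitE (fun v => censusTest c O v.1 v.2) := by
  have hx : CodeFP (pairE strE natE) strE (fun v => v.1) := fst _ _
  have hi : CodeFP (pairE strE natE) natE (fun v => v.2) := snd _ _
  have hn : CodeFP (pairE strE natE) natE (fun v => v.1.length) := strNatLength.comp hx
  have hname0 : CodeFP (pairE strE natE) nameE (fun v => ((0 : ℕ), v.1.length, v.2, (0 : ℕ), (0 : ℕ))) :=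
    (const _ (0 : ℕ)).pair (hn.pair (hi.pair ((const _ (0 : ℕ)).pair (const _ (0 : ℕ)))))
  have hname1 : CodeFP (pairE strE natE) nameE
      (fun v => ((0 : ℕ), v.1.length, v.2 + 1, (0 : ℕ), (0 : ℕ))) :=
    (const _ (0 : ℕ)).pair (hn.pair ((natAdd.comp (hi.pair (const _ (1 : ℕ)))).pair
      ((const _ (0 : ℕ)).pair (const _ (0 : ℕ)))))
  have ho0 : CodeFP (pairE strE natE) bitE (fun v => O (qcap c v.1 (0, v.1.length, v.2, 0, 0))) :=
    (hO.comp ((qcapC c).comp (hx.pair hname0))).congr fun _ => by dsimp only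
  have ho1 : CodeFP (pairE strE natE) bitE (fun v => O (qcap c v.1 (0, v.1.length, v.2 + 1, 0, 0))) :=
    (hO.comp ((qcapC c).comp (hx.pair hname1))).congr fun _ => by dsimp only
  have hrng : CodeFP (pairE strE natE) (rawE natE)
      (fun v => List.range (min v.2 (v.1.length ^ c + c + 1))) :=
    (rangeOf.comp (((nbudgetC c).comp hx).pair hi)).congr fun _ => by dsimp only
  have hrows : CodeFP (pairE strE natE) bitE
      (fun v => (List.range (min v.2 (v.1.length ^ c + c + 1))).any fun r => rowTest c O v.1 v.2 r) :=
    ((any (rowTestC (c := c) hO)).comp ((CodeFP.id _).pair hrng)).congr fun _ => by dsimp only [id]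
  exact ((ho0.and ho1.not).and hrows).congr fun _ => by dsimp only [censusTest]

/-- **The census decider is polynomial time** ("we run an exponential in `log n` algorithm at most a
polynomial in `n` number of times", p. 164; here: polynomially many polynomial-length tally queries
to a polynomial-time oracle bit `O`). [cite: HartmanisImmermanSewelson1985, proof of Theorem 1 (p. 164)] -/
theorem decC : CodeFP strE bitE (dec c O) :=
  ((any (censusTestC (c := c) hO)).comp ((CodeFP.id strE).pair (urange.comp (nbudgetC c)))).congr
    fun _ => by dsimp only [dec, id]

end DeciderFP

/-! ### E. `tallyOf S ∈ P` forces a sparse `S` into `P` -/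

/-- The oracle bit of a `P` language is polynomial time (its deciding machine). [folklore] -/
theorem indicatorC {T : Language Bool} (hT : T ∈ Classes.P) : CodeFP strE bitE fun w => T.boolIndicator w :=
  of_fn _ (indicatorFn_mem_FP hT) fun _ => rfl

/-- **If the census tally set of a sparse language `S` is in `P`, then `S ∈ P`** (the upward
separation method of Hartmanis–Immerman–Sewelson, Theorem 1, `⇒`: "knowing the census `cₙ` … we
simply run our … algorithm for `S'` on [the naming queries]; `x` will be in `S` if and only if for
some [row] all of the appropriate [queries] are in `S'`", with the tally set `tallyOf S` in the role
of `S' ∈ EXPTIME`). [cite: HartmanisImmermanSewelson1985, Theorem 1 (proof, p. 164)] -/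
theorem mem_P_of_tallyOf_mem_P {S : Language Bool} (hS : IsSparseLanguage S)
    (hT : tallyOf S ∈ Classes.P) : S ∈ Classes.P := by
  obtain ⟨c, hc⟩ := hS
  have hO : ∀ q : Name, (tallyOf S).boolIndicator (List.replicate (pair5 q) false) = true ↔ NameOK S q :=
    fun q => (Set.mem_iff_boolIndicator _ _).symm.trans (replicate_mem_tallyOf_iff S q)
  obtain ⟨F, hF, hFd⟩ := decC (c := c) (indicatorC hT)
  refine mem_P_of_mem_FP hF S fun x => ?_
  have hx : F x = [dec c (fun w => (tallyOf S).boolIndicator w) x] := hFd x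
  rw [hx]
  constructor
  · intro h
    rw [(dec_eq_true_iff hc hO x).2 h]
  · intro h
    have h' : dec c (fun w => (tallyOf S).boolIndicator w) x = false := by
      rw [← Bool.not_eq_true]
      exact fun h' => h ((dec_eq_true_iff hc hO x).1 h')
    rw [h']

end SparseTally

/-- **Hartmanis–Immerman–Sewelson 1985, Corollary 4** (Information and Control 65, p. 166): there are
sparse sets in `NP − P` iff there are tally sets in `NP − P`. (`⇐`) tally sets are sparse
(`IsTally.isSparseLanguage`). (`⇒`) for a sparse `S ∈ NP − P` the census tally set `tallyOf S` is
tally, in `NP` (`SparseTally.tallyOf_mem_NP`), and not in `P`, since `tallyOf S ∈ P` would put `S`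
in `P` by the census decider (`SparseTally.mem_P_of_tallyOf_mem_P`) — the printed route "Theorem 1 +
Book's tally translation" with the exponential padding and its inverse composed away. [cite: HartmanisImmermanSewelson1985, Corollary 4 (p. 166); Theorem 1 (pp. 163–164)] -/
theorem hartmanisImmermanSewelson1985_cor4_holds : hartmanisImmermanSewelson1985_cor4 := by
  constructor
  · rintro ⟨S, hsp, hNP, hP⟩
    exact ⟨SparseTally.tallyOf S, SparseTally.isTally_tallyOf S, SparseTally.tallyOf_mem_NP hNP,
      fun hT => hP (SparseTally.mem_P_of_tallyOf_mem_P hsp hT)⟩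
  · rintro ⟨T, hT, hNP, hP⟩
    exact ⟨T, hT.isSparseLanguage, hNP, hP⟩

end Literature.Computability.Complexity
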